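import Summits.NavierStokesRegularity.NavierStokesRegularity.Theorems.ScenarioCensusTemporalSpectrumQuasiRow
import Summits.NavierStokesRegularity.NavierStokesRegularity.Theorems.ScenarioCensusModeRankShell
import Summits.NavierStokesRegularity.NavierStokesRegularity.Theorems.ScenarioCensusFloquetMeterCells
import HarnessLib

/-!
# LINE «temporal-spectrum» port, part 12/12: §R the operator-form head modulo the ODE representation lemma (`OdeQuasiPolyRepr`, `row_A1qp_of_odeRepr`, orders 0 and 1);
# census KEYS `Row_A1ex` / `Row_A1po` / `Row_A1jb` / `Row_A1cs` / `Row_A1qx` + `_excluded`, `Row_A1qp` (OPEN), display `row_A1cx_iff` (key `Row_A1cx` = floquet-meter port)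

Re-homed for the scenario census (typer seat ns-census-typer-1 g8; the cells A1ex / A1po are MEMBERS OF RECORD «DECIDED IN KERNEL IN FILES» of row A1apT since census
v1.69 and A1jb / A1cs / A1qx / A1cx since v1.71 (critic idea-crit-3 g6 PASS — no price 20:33:05Z, RE-STAMPs REV 2 → REV 3 → REV 4 22:13:50Z; ref ns-census-ref g8
PRE-CHECK ✓ §13.14 item 11 + items 19/20; lit §21.21 / §21.24 (a)); this port makes them TREE-decided): VERBATIM PORT of ns-idea-2 LINE g12-2 «temporal-spectrum»
REV 4, `pub/ideators/ns-idea-2/lines/temporal-spectrum/line-temporal-spectrum.lean` sha16 f2331f3a0765e1d4 (3431 l., lean check rc 0, 0 sorry), split for the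
400-line rule into twelve parts `ScenarioCensusTemporalSpectrum{∅, Exponential, Oscillatory, OscillatoryRow, Jordan, Complex, ComplexDecay, ComplexRow, Quasi, QuasiGroup,
QuasiRow, Head}` (chain imports).  Lean text VERBATIM in namespace `…Theorems.ScenarioCensus.TemporalSpectrum` (the line's `…Lines.TemporalSpectrum` re-homed);
port edits: the two `local notation "E3"` lines → one `abbrev E3` at namespace level and the bracket lines `section Rows` / `end Rows` dropped (no `variable`s
there; typer lint: no notation in port files), `@[conjecture]` on the OPEN head `Row_A1qp` (typed only), twenty-one one-line docstrings added (gate lint); the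
lemmas the line shares VERBATIM with «mode-rank» / «floquet-meter» (§B spatial Liouville lemmas, the instrument `vortB` / `vortB_sum_sum`, the gauge
`tendsto_slice_atBot` / `eq_zero_of_curl_slice_const`, `laplacian_zero_apply`, `norm_curl_le_four_mul`) are taken BY NAME from those landed ports (listed
below); `tendsto_typeI_bound` (twin of a landed tree lemma in a module the farm does not build) is not re-declared and its four uses carry the one-line
Mathlib proof inline (proof text only).  Statements untouched.

No census VALUE is moved here (row A1apT keeps its value; the members become TREE-decided by name); NS regularity is NOT proved; (L′) ⟨10661⟩ is
untouched; no summit statement is proved by this file. Lemmas that restate already-landed tree declarations are taken BY NAME (gate lint `dedup.landed`): `apply_eq_apply_of_harmonic_bounded` = `ModeRank.apply_eq_apply_of_harmonic_bounded`, `apply_eq_apply_of_curl_const` = `ModeRank.apply_eq_apply_of_curl_const`, `nonpos_of_laplacian_eq_mul` = `ModeRank.nonpos_of_laplacian_eq_mul`, `eq_zero_of_laplacian_eq_smul_of_pos` = `ModeRank.eq_zero_of_laplacian_eq_smul_of_pos`, `vortB` = `ModeRank.vortB`, `vortB_sum_sum` = `ModeRank.vortB_sum_sum`, `tendsto_slice_atBot`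 = `ModeRank.tendsto_slice_atBot`, `eq_zero_of_curl_slice_const` = `ModeRank.eq_zero_of_curl_slice_const`, `laplacian_zero_apply` = `ModeRank.laplacian_zero_fun`, `norm_curl_le_four_mul` = `FloquetMeter.norm_curl_le_four_mul`.
-/

-- the summit and its single problem share the name `NavierStokesRegularity` (D-0017 nested layout)
set_option linter.dupNamespace false

noncomputable section

open Set Function Filter Topology

namespace Summit.NavierStokesRegularity.NavierStokesRegularity.Theorems.ScenarioCensus.TemporalSpectrum

open Literature.Analysis Literature.Analysis.FluidPDE InnerProductSpace
open Summit.NavierStokesRegularity.NavierStokesRegularity.Theorems (vorticity_eq_deriv_of_typeI)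
open scoped Laplacian InnerProductSpace RealInnerProductSpace ContDiff

/-! ## R. The operator-form head modulo the ODE representation lemma (REV 4)

`Row_A1qp` quantifies over an abstract monic constant-coefficient ODE in `t`; `Row_A1qx` over the
explicit quasi-polynomial slice families such an ODE produces.  The passage between them is pure linear
ODE theory with no Navier–Stokes content: the real Jordan–Floquet solution basis
`t^m e^{at} cos(bt)`, `t^m e^{at} sin(bt)` of `v⁽ⁿ⁾ + ∑ₘ cₘ v⁽ᵐ⁾ = 0` together with the fact that the
coefficient vectors of a solution are FIXED scalar combinations of finitely many of its values `v(τᵢ)`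
(inverse of an evaluation matrix of the basis).  We type this NS-free fact as the Prop
`OdeQuasiPolyRepr` (not in Mathlib — the line's one remaining open obligation; its rungs `n = 0, 1` are
proved below, `n ≥ 2` is open and typed) and prove `OdeQuasiPolyRepr → Row_A1qp` in kernel.  On the
Navier–Stokes side nothing is assumed: the sup bound for the curls of the slices of the class, which the
curl hypotheses of `Row_A1qx` require, is DERIVED from the tree's bounded-mild bootstrap
`exists_norm_iteratedFDeriv_le_of_bounded_oseenMild` applied to the time-shifted field `u(· - δ)`
(`IsTypeIAncientMild.comp_sub_right`; bounded by `C/√δ`), and `‖curl v‖ ≤ 4 ‖Dv‖`. -/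

-- `abs_apply_le_norm'`: the coordinate bound is used only by `norm_curl_le_four_mul` (taken BY NAME from the floquet-meter port); not re-declared.

-- `norm_curl_le_four_mul`: the line restates the tree's `FloquetMeter.norm_curl_le_four_mul`; taken BY NAME (gate lint dedup.landed).

/-- **The vorticity of every slice of the class is bounded** (derived, not assumed): shift time by
`δ = -t₀/2` (`comp_sub_right`, the shifted field is bounded by `C/√δ` up to `t = 0`), apply the tree's
bounded-mild derivative bootstrap `exists_norm_iteratedFDeriv_le_of_bounded_oseenMild` (order `1`) on a
window around `t₀/2`, and use `‖curl v‖ ≤ 4‖Dv‖`. -/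
theorem typeI_exists_curl_bound {C : ℝ} {u : ℝ → E3 → E3} (hu : IsTypeIAncientMild C u)
    {t₀ : ℝ} (ht₀ : t₀ < 0) : ∃ A : ℝ, ∀ x, ‖curl (u t₀) x‖ ≤ A := by
  have hδ : 0 < -t₀ / 2 := by linarith
  have hℓ : (0 : ℝ) < 1 - t₀ / 4 := by linarith
  obtain ⟨K, hK⟩ :=
    exists_norm_iteratedFDeriv_le_of_bounded_oseenMild (C / Real.sqrt (-t₀ / 2)) 1 hℓ one_pos
  have hw : IsTypeIAncientMild C (fun t => u (t - -t₀ / 2)) := hu.comp_sub_right hδ.le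
  have hAa : t₀ / 2 - 1 - 1 < t₀ / 2 - 1 := by linarith
  have haℓ : t₀ / 2 - 1 + (1 - t₀ / 4) < 0 := by linarith
  have hcont : ContinuousOn (uncurry fun t => u (t - -t₀ / 2)) (Ioo (t₀ / 2 - 1 - 1) 0 ×ˢ univ) :=
    hw.continuousOn_uncurry.mono (prod_mono Ioo_subset_Iio_self Subset.rfl)
  have hdiv : ∀ t ∈ Ioo (t₀ / 2 - 1 - 1) 0, IsWeaklyDivFree ((fun t => u (t - -t₀ / 2)) t) :=
    fun t ht => hw.isWeaklyDivFree ht.2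
  have hmild : ∀ s t : ℝ, t₀ / 2 - 1 - 1 < s → s < t → t < 0 → ∀ x,
      (fun t => u (t - -t₀ / 2)) t x
        = UnboundedOperators.heatExtension ((fun t => u (t - -t₀ / 2)) s) (t - s) x
          - oseenDuhamel 1 s (fun t => u (t - -t₀ / 2)) (fun t => u (t - -t₀ / 2)) t x :=
    fun s t _ hst ht x => hw.mild_eq_heatExtension hst ht x
  have hbd : ∀ t ∈ Ioo (t₀ / 2 - 1 - 1) 0, ∀ x,
      ‖(fun t => u (t - -t₀ / 2)) t x‖ ≤ C / Real.sqrt (-t₀ / 2) := by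
    intro t ht x
    have h1 := hu.norm_le (t := t - -t₀ / 2) (by linarith [ht.2]) x
    refine h1.trans ?_
    exact div_le_div_of_nonneg_left hu.nonneg (Real.sqrt_pos.2 hδ)
      (Real.sqrt_le_sqrt (by linarith [ht.2]))
  have hmem : t₀ / 2 ∈ Ico (t₀ / 2 - 1 + 1) (t₀ / 2 - 1 + (1 - t₀ / 4)) := ⟨by linarith, by linarith⟩
  have hKs := hK hAa haℓ hcont hdiv hmild hbd (t₀ / 2) hmem
  refine ⟨4 * K, fun x => ?_⟩
  have hws : u (t₀ / 2 - -t₀ / 2) = u t₀ := by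
    congr 1; ring
  have h1 := hKs x
  rw [hws] at h1
  rw [← norm_iteratedFDeriv_fderiv, norm_iteratedFDeriv_zero] at h1
  exact (FloquetMeter.norm_curl_le_four_mul (u t₀) x).trans (by linarith)

/-- **The typed NS-free obligation at order `n`** (REV 4): a UNIFORM real quasi-polynomial
representation of the smooth `E3`-valued solutions on `(-∞,0)` of the monic constant-coefficient ODE
`v⁽ⁿ⁾ + ∑_{m<n} cₘ v⁽ᵐ⁾ = 0` — finitely many distinct rates `aₖ + i bₖ` (`bₖ ≥ 0`), powers `m < d`,
and coefficient vectors that are FIXED scalar combinations `∑ᵢ αₖₘᵢ v(τᵢ)`, `∑ᵢ βₖₘᵢ v(τᵢ)` of finitely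
many values of the solution at times `τᵢ < 0` (the data depend on `n, c` only, not on `v`).  Textbook
linear ODE algebra (Jordan–Floquet basis + an invertible evaluation matrix of the basis); not in Mathlib. -/
def OdeQuasiPolyReprAt (n : ℕ) : Prop :=
  ∀ (c : Fin n → ℝ),
    ∃ (N d T : ℕ) (a b : Fin N → ℝ) (τ : Fin T → ℝ) (α β : Fin N → ℕ → Fin T → ℝ),
      (∀ k, 0 ≤ b k) ∧ Function.Injective (fun k => (a k, b k)) ∧ (∀ i, τ i < 0) ∧
      ∀ v : ℝ → E3, ContDiffOn ℝ (⊤ : ℕ∞) v (Set.Iio 0) →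
        (∀ t < 0, iteratedDeriv n v t + ∑ m : Fin n, c m • iteratedDeriv (m : ℕ) v t = 0) →
        ∀ t < 0, v t = ∑ k, ∑ m ∈ Finset.range d, (Real.exp (a k * t) * t ^ m) •
          (Real.cos (b k * t) • ∑ i, α k m i • v (τ i) + Real.sin (b k * t) • ∑ i, β k m i • v (τ i))

/-- **The typed NS-free obligation** (all orders): the line's one remaining open item after REV 4. -/
def OdeQuasiPolyRepr : Prop := ∀ n, OdeQuasiPolyReprAt n

/-- **REV 4: the operator-form head modulo the ODE representation lemma.**  Given the NS-free
representation `OdeQuasiPolyRepr`, every element of the class whose time signals satisfy one monic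
constant-coefficient ODE vanishes: its slices are an explicit quasi-polynomial family whose coefficient
fields `∑ᵢ αₖₘᵢ u(τᵢ,·)` are `C³` (`contDiff_slice`) with bounded curls (`typeI_exists_curl_bound`,
`curl_sum_smul'`), so `row_A1qx_holds` applies.  Nothing on the Navier–Stokes side is assumed. -/
theorem row_A1qp_of_odeRepr (hR : OdeQuasiPolyRepr) : Row_A1qp := by
  intro C u hu n c hODE
  obtain ⟨N, d, T, a, b, τ, α, β, hb, hinj, hτ, hrep⟩ := hR n c
  have hsl : ∀ i, ContDiff ℝ 3 (u (τ i)) := fun i =>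
    (hu.contDiff_slice (hτ i)).of_le (by norm_cast)
  have hdf : ∀ i, Differentiable ℝ (u (τ i)) := fun i => (hsl i).differentiable (by norm_num)
  obtain ⟨A, hA⟩ : ∃ A : Fin T → ℝ, ∀ i x, ‖curl (u (τ i)) x‖ ≤ A i := by
    have h : ∀ i, ∃ A : ℝ, ∀ x, ‖curl (u (τ i)) x‖ ≤ A := fun i =>
      typeI_exists_curl_bound hu (hτ i)
    choose A hA using h
    exact ⟨A, hA⟩
  have hcomb_cd : ∀ γ : Fin T → ℝ, ContDiff ℝ 3 (fun x => ∑ i, γ i • u (τ i) x) := fun γ =>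
    ContDiff.sum fun i _ => (hsl i).const_smul (γ i)
  have hcomb_bd : ∀ γ : Fin T → ℝ, ∃ B : ℝ, ∀ x, ‖curl (fun y => ∑ i, γ i • u (τ i) y) x‖ ≤ B := by
    intro γ
    refine ⟨∑ i, |γ i| * A i, fun x => ?_⟩
    rw [curl_sum_smul' hdf γ x]
    refine (norm_sum_le _ _).trans (Finset.sum_le_sum fun i _ => ?_)
    rw [norm_smul, Real.norm_eq_abs]
    exact mul_le_mul_of_nonneg_left (hA i x) (abs_nonneg _)
  refine row_A1qx_holds C u hu N d a b (fun k m x => ∑ i, α k m i • u (τ i) x)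
    (fun k m x => ∑ i, β k m i • u (τ i) x) hb hinj (fun k m => hcomb_cd (α k m))
    (fun k m => hcomb_cd (β k m)) (fun k m => hcomb_bd (α k m)) (fun k m => hcomb_bd (β k m)) ?_
  intro t ht x
  have hv : ContDiffOn ℝ (⊤ : ℕ∞) (fun s => u s x) (Set.Iio 0) := by
    have e : (fun s => u s x) = uncurry u ∘ fun s => (s, x) := rfl
    rw [e]
    refine hu.contDiffOn.comp (contDiff_prodMk_left x).contDiffOn ?_
    intro s hs
    exact mk_mem_prod hs (mem_univ x)
  exact hrep (fun s => u s x) hv (fun s hs => hODE x s hs) t ht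

/-- Rung `n = 0` of the obligation: the equation reads `v = 0`; the empty quasi-polynomial. -/
theorem odeQuasiPolyReprAt_zero : OdeQuasiPolyReprAt 0 := by
  intro c
  refine ⟨0, 0, 0, Fin.elim0, Fin.elim0, Fin.elim0, fun k => k.elim0, fun k => k.elim0,
    fun k => k.elim0, fun k => k.elim0, fun i => i.elim0, ?_⟩
  intro v _ hODE t ht
  have h := hODE t ht
  simp only [iteratedDeriv_zero, Finset.univ_eq_empty, Finset.sum_empty, add_zero] at h
  simp [h]

/-- Constancy on `(-∞,0)` from a vanishing derivative (mean value theorem on the convex set `Iio 0`). -/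
theorem eq_of_deriv_eq_zero_Iio {w : ℝ → E3} (hw : DifferentiableOn ℝ w (Set.Iio 0))
    (hw' : ∀ s < 0, deriv w s = 0) {t : ℝ} (ht : t < 0) : w t = w (-1) := by
  refine (convex_Iio (0:ℝ)).is_const_of_fderivWithin_eq_zero hw ?_ ht (by norm_num)
  intro s hs
  rw [fderivWithin_of_isOpen isOpen_Iio hs, ← toSpanSingleton_deriv, hw' s hs]
  simp

/-- Rung `n = 1` of the obligation: `v' + c₀ v = 0` on `(-∞,0)` forces `v(t) = e^{-c₀(t+1)} v(-1)`
(`e^{c₀ t} v(t)` has zero derivative on the connected open set `Iio 0`). -/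
theorem odeQuasiPolyReprAt_one : OdeQuasiPolyReprAt 1 := by
  intro c
  refine ⟨1, 1, 1, fun _ => -c 0, fun _ => 0, fun _ => -1, fun _ _ _ => Real.exp (-c 0),
    fun _ _ _ => 0, fun _ => le_rfl, fun i j _ => Subsingleton.elim i j, fun _ => by norm_num, ?_⟩
  intro v hv hODE t ht
  have hd : ∀ s < 0, DifferentiableAt ℝ v s := fun s hs =>
    ((hv.differentiableOn (by simp)) s hs).differentiableAt (isOpen_Iio.mem_nhds hs)
  have hODE' : ∀ s < 0, deriv v s + c 0 • v s = 0 := by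
    intro s hs
    have h := hODE s hs
    simpa [iteratedDeriv_one, iteratedDeriv_zero, Fin.sum_univ_one] using h
  have hwd : ∀ s < 0, HasDerivAt (fun r => Real.exp (c 0 * r) • v r)
      ((Real.exp (c 0 * s) * c 0) • v s + Real.exp (c 0 * s) • deriv v s) s := by
    intro s hs
    have he : HasDerivAt (fun r => Real.exp (c 0 * r)) (Real.exp (c 0 * s) * c 0) s := by
      have h := ((hasDerivAt_id s).const_mul (c 0)).exp
      simpa using h
    have h := he.smul (hd s hs).hasDerivAt
    rw [add_comm] at h
    exact h
  have hwdiff : DifferentiableOn ℝ (fun r => Real.exp (c 0 * r) • v r) (Set.Iio 0) :=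
    fun s hs => (hwd s hs).differentiableAt.differentiableWithinAt
  have hw0 : ∀ s < 0, deriv (fun r => Real.exp (c 0 * r) • v r) s = 0 := by
    intro s hs
    rw [(hwd s hs).deriv]
    have h := hODE' s hs
    have e : (Real.exp (c 0 * s) * c 0) • v s + Real.exp (c 0 * s) • deriv v s
        = Real.exp (c 0 * s) • (deriv v s + c 0 • v s) := by
      rw [smul_add, smul_smul, add_comm]
    rw [e, h, smul_zero]
  have hw := eq_of_deriv_eq_zero_Iio hwdiff hw0 ht
  have key : v t = (Real.exp (-c 0 * t) * Real.exp (-c 0)) • v (-1) := by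
    have h1 : Real.exp (-c 0 * t) * Real.exp (c 0 * t) = 1 := by
      rw [← Real.exp_add, show -c 0 * t + c 0 * t = 0 by ring, Real.exp_zero]
    calc v t = (Real.exp (-c 0 * t) * Real.exp (c 0 * t)) • v t := by rw [h1, one_smul]
      _ = Real.exp (-c 0 * t) • (Real.exp (c 0 * t) • v t) := by rw [mul_smul]
      _ = Real.exp (-c 0 * t) • (Real.exp (c 0 * (-1)) • v (-1)) := by
          have h2 : Real.exp (c 0 * t) • v t = Real.exp (c 0 * (-1)) • v (-1) := hw
          rw [h2]
      _ = (Real.exp (-c 0 * t) * Real.exp (-c 0)) • v (-1) := by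
          rw [smul_smul, show c 0 * (-1) = -c 0 by ring]
  rw [key]
  simp only [Finset.univ_unique, Fin.default_eq_zero, Fin.isValue, Finset.sum_singleton,
    Finset.sum_range_one, pow_zero, mul_one, zero_mul, Real.cos_zero, one_mul, Real.sin_zero,
    zero_smul, add_zero, smul_smul]

/-- Bookkeeping (REV 4): the NS side of the head is closed — the head follows from the NS-free
obligation, whose first two rungs hold. -/
theorem temporalSpectrum_head_reduced :
    (OdeQuasiPolyRepr → Row_A1qp) ∧ OdeQuasiPolyReprAt 0 ∧ OdeQuasiPolyReprAt 1 :=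
  ⟨row_A1qp_of_odeRepr, odeQuasiPolyReprAt_zero, odeQuasiPolyReprAt_one⟩

end Summit.NavierStokesRegularity.NavierStokesRegularity.Theorems.ScenarioCensus.TemporalSpectrum

namespace Summit.NavierStokesRegularity.NavierStokesRegularity.Theorems.ScenarioCensus

/-! ## Census KEYS (ns `…Theorems.ScenarioCensus`): instrument TEMPORAL SPECTRUM on row A1apT — TREE-decided members A1ex / A1po / A1jb / A1cs / A1qx, OPEN head A1qp -/

/-- **Cell A1ex** (real simple temporal spectrum `u = ∑ₖ e^{σₖt} φₖ(x)`, distinct real rates, `C³` profiles with bounded curls ⇒ `u ≡ 0`): `:= TemporalSpectrum.Row_A1ex`. DECIDED. -/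
def Row_A1ex : Prop := TemporalSpectrum.Row_A1ex
/-- A1ex is EXCLUDED (decided in the tree): `TemporalSpectrum.row_A1ex_holds`. -/
theorem row_A1ex_excluded : Row_A1ex := TemporalSpectrum.row_A1ex_holds

/-- **Cell A1po** (polynomial time dependence `u = ∑_{m<n} t^m φₘ(x)` ⇒ `u ≡ 0`): `:= TemporalSpectrum.Row_A1po`. DECIDED. -/
def Row_A1po : Prop := TemporalSpectrum.Row_A1po
/-- A1po is EXCLUDED (decided in the tree): `TemporalSpectrum.row_A1po_holds`. -/
theorem row_A1po_excluded : Row_A1po := TemporalSpectrum.row_A1po_holds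

/-- **Cell A1jb** (one real rate with a Jordan block `u = e^{at} ∑_{m<n} t^m ψₘ(x)` ⇒ `u ≡ 0`): `:= TemporalSpectrum.Row_A1jb`. DECIDED. -/
def Row_A1jb : Prop := TemporalSpectrum.Row_A1jb
/-- A1jb is EXCLUDED (decided in the tree): `TemporalSpectrum.row_A1jb_holds`. -/
theorem row_A1jb_excluded : Row_A1jb := TemporalSpectrum.row_A1jb_holds

/-- **Cell A1cs** (finite complex simple temporal spectrum `u = ∑ₖ e^{aₖt}(cos bₖt ψₖ + sin bₖt χₖ)` ⇒ `u ≡ 0`): `:= TemporalSpectrum.Row_A1cs`. DECIDED. -/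
def Row_A1cs : Prop := TemporalSpectrum.Row_A1cs
/-- A1cs is EXCLUDED (decided in the tree): `TemporalSpectrum.row_A1cs_holds`. -/
theorem row_A1cs_excluded : Row_A1cs := TemporalSpectrum.row_A1cs_holds

/-- **Cell A1qx** (the full explicit quasi-polynomial cell: Jordan blocks ⊗ oscillation ⇒ `u ≡ 0`): `:= TemporalSpectrum.Row_A1qx`. DECIDED. -/
def Row_A1qx : Prop := TemporalSpectrum.Row_A1qx
/-- A1qx is EXCLUDED (decided in the tree): `TemporalSpectrum.row_A1qx_holds`. -/
theorem row_A1qx_excluded : Row_A1qx := TemporalSpectrum.row_A1qx_holds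

/-- **Row A1qp** (the operator-form head: time signals annihilated by one monic constant-coefficient ODE ⇒ `u ≡ 0`) — typed only; reduced to the NS-free ODE representation lemma `TemporalSpectrum.OdeQuasiPolyRepr` by `TemporalSpectrum.row_A1qp_of_odeRepr`: `:= TemporalSpectrum.Row_A1qp`. OPEN (no witness, no proof). -/
@[conjecture] def Row_A1qp : Prop := TemporalSpectrum.Row_A1qp

/-- Display: the temporal-spectrum's cell `Row_A1cx` is VERBATIM the census key `Row_A1cx` (keyed by the floquet-meter port): definitional `Iff.rfl`. -/
theorem row_A1cx_iff : TemporalSpectrum.Row_A1cx ↔ Row_A1cx := Iff.rfl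
/-- Lattice edge at key level: the OPEN head A1qp follows from the NS-free ODE representation lemma (`TemporalSpectrum.row_A1qp_of_odeRepr`). -/
theorem row_A1qp_of_odeRepr : TemporalSpectrum.OdeQuasiPolyRepr → Row_A1qp := TemporalSpectrum.row_A1qp_of_odeRepr
/-- Lattice edges at key level: the head A1qp implies the decided faces A1ex / A1po / A1cx (`TemporalSpectrum.cells_of_row_A1qp`). -/
theorem cells_of_row_A1qp : Row_A1qp → Row_A1ex ∧ Row_A1po ∧ Row_A1cx := TemporalSpectrum.cells_of_row_A1qp

end Summit.NavierStokesRegularity.NavierStokesRegularity.Theorems.ScenarioCensus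

end
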